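import Summits.QuantumFields.YangMills.Theorems.LangevinControlUVOSLegsFromFemtoAndGapStubAssemblyRPReindex
import Summits.QuantumFields.YangMills.Theorems.LangevinControlUVOSLegsFromFemtoAndGapStubAssemblyDensityExpansion
import HarnessLib

/-!
# Soft OS-assembly toolkit XX: the reflection-positivity square versus the lattice OS form

Helper file for stub `stub_assembly6` of crux `OSLegsFromFemtoAndGap` (stmt-QuantumFields-9367, line
`dlr-collar-transfer`, reshape r2).  For a pair of test functions `Fᵢ, Fⱼ` and a witness `H` of `ΘFᵢ* ⊗ Fⱼ`:
* `latticeDist_dens_eq_rpSum` (**Z**): the lattice OS form `latticeDist (dens) H` is the plane-string sum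
  `Σ_{q,p} Σ_{x,y} conj Fᵢ(θ(a x∘rev)) Fⱼ(a y) W^{q++p}(x ++ y)`;
* `rpShifted_eq_apply_H` (**P**): the reindexed reflection-positivity term of toolkit XIX is the same sum with `H`
  evaluated at the points shifted by `cshift a q` (`‖cshift‖ ≤ a`);
* `norm_rpDefect_le` (**Z − P = O(a)**): given the shift-defect bound for plane strings (exported by the joint soft
  legs), `‖Z − P‖ ≤ 6ⁿ 6ᵏ · 2 a K^{n+k} Σ⁺(H)`.
-/

noncomputable section

open scoped SchwartzMap BigOperators ComplexConjugate
open MeasureTheory Filter Topology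
open Literature.MathematicalPhysics.QuantumFieldTheory Literature.MathematicalPhysics.QuantumLattice
open Literature.MathematicalPhysics.AQFT
open Literature.Probability.LatticeModels (box Site)
open Summit.QuantumFields.YangMills.Cruxes.OSLegsFromFemtoAndGap.DlrCollarTransfer (dens)

namespace Summit.QuantumFields.YangMills.Theorems.OSLegsFromFemtoAndGap

local notation "E4" => EuclideanSpace ℝ (Fin 4)

/-! ### Appended index sets -/

/-- **Sums over appended multi-indices**: `Σ_{r : Fin (n+k) → s} f r = Σ_{q : Fin n → s} Σ_{p : Fin k → s} f (q ++ p)`. -/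
theorem sum_piFinset_append {α M : Type*} [AddCommMonoid M] {n k : ℕ} (s : Finset α) (f : (Fin (n + k) → α) → M) :
    ∑ r ∈ Fintype.piFinset (fun _ : Fin (n + k) => s), f r =
      ∑ q ∈ Fintype.piFinset (fun _ : Fin n => s), ∑ p ∈ Fintype.piFinset (fun _ : Fin k => s), f (Fin.append q p) := by
  classical
  rw [← Finset.sum_product']
  refine Finset.sum_bij' (fun r _ => (fun i => r (Fin.castAdd k i), fun j => r (Fin.natAdd n j)))
    (fun qp _ => Fin.append qp.1 qp.2) (fun r hr => ?_) (fun qp hqp => ?_) (fun r _ => ?_) (fun qp _ => ?_)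
    (fun r _ => by rw [Fin.append_castAdd_natAdd])
  · simp only [Finset.mem_product, Fintype.mem_piFinset] at hr ⊢
    exact ⟨fun i => hr _, fun j => hr _⟩
  · simp only [Finset.mem_product, Fintype.mem_piFinset] at hqp ⊢
    intro l
    induction l using Fin.addCases with
    | left i => rw [Fin.append_left]; exact hqp.1 i
    | right j => rw [Fin.append_right]; exact hqp.2 j
  · exact Fin.append_castAdd_natAdd
  · ext <;> simp

/-- Appending compositions. -/
theorem append_comp_eq {α β : Type*} {n k : ℕ} (m : α → β) (q : Fin n → α) (p : Fin k → α) :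
    Fin.append (fun l => m (q l)) (fun l => m (p l)) = fun i => m (Fin.append q p i) := by
  funext i
  induction i using Fin.addCases with
  | left i => simp
  | right j => simp

/-! ### The shift vector -/

/-- The unit time vector `e₀` in physical units has norm one. -/
theorem norm_siteToE_single : ‖siteToE (Pi.single (0 : Fin 4) (1 : ℤ))‖ = 1 := by
  rw [EuclideanSpace.norm_eq, Fin.sum_univ_four]
  simp [siteToE_apply]

/-- `θ e₀ = −e₀`. -/
theorem timeReflection_siteToE_single :
    timeReflection 4 (siteToE (Pi.single (0 : Fin 4) (1 : ℤ))) = -siteToE (Pi.single (0 : Fin 4) (1 : ℤ)) := by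
  ext k
  rw [timeReflection_apply, PiLp.neg_apply, siteToE_apply]
  by_cases hk : k = 0
  · subst hk; simp
  · simp [hk]

/-- **The shift vector** of the first block: `−a (1 − [q l temporal]) e₀` on the first `n` slots, `0` on the last `k`. -/
def cshift (a : ℝ) {n : ℕ} (q : Fin n → Fin 4 × Fin 4) (k : ℕ) : Fin (n + k) → E4 :=
  Fin.append (fun l => (-(a * (1 - if (q l).1 = 0 then 1 else 0))) • siteToE (Pi.single (0 : Fin 4) (1 : ℤ)))
    (fun _ => 0)

/-- Components of the shift vector are at most `a`. -/
theorem norm_cshift_apply_le {a : ℝ} (ha : 0 ≤ a) {n : ℕ} (q : Fin n → Fin 4 × Fin 4) (k : ℕ) (l : Fin (n + k)) :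
    ‖cshift a q k l‖ ≤ a := by
  unfold cshift
  induction l using Fin.addCases with
  | left i =>
      rw [Fin.append_left, norm_smul, norm_siteToE_single, mul_one, norm_neg, Real.norm_eq_abs,
        abs_of_nonneg (by split_ifs <;> nlinarith)]
      split_ifs <;> nlinarith
  | right j => rw [Fin.append_right, norm_zero]; exact ha

/-- The shift vector has norm at most `a`. -/
theorem norm_cshift_le {a : ℝ} (ha : 0 ≤ a) {n : ℕ} (q : Fin n → Fin 4 × Fin 4) (k : ℕ) : ‖cshift a q k‖ ≤ a :=
  (pi_norm_le_iff_of_nonneg ha).2 (norm_cshift_apply_le ha q k)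

variable {G : Type} [Group G] [TopologicalSpace G] [IsTopologicalGroup G] [CompactSpace G]
  [MeasurableSpace G] [BorelSpace G]

/-! ### Z: the lattice OS form as a plane-string sum -/

/-- **Z.** The lattice OS form of a witness `H` of `ΘFᵢ* ⊗ Fⱼ` against the canonical centred density
distribution, as the plane-string sum at the actual sites. -/
theorem latticeDist_dens_eq_rpSum (r : LatticeRep G) (β : ℝ) (L : ℕ) (a : ℝ) {n k : ℕ}
    (Fi : 𝓢((Fin n → E4), ℂ)) (Fj : 𝓢((Fin k → E4), ℂ)) (H : 𝓢((Fin (n + k) → E4), ℂ))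
    (hH : IsAppendTensorOf H (osAdjoint Fi) Fj) :
    latticeDist r.ρ β L a r.curvature.F (wilsonTorusMean r.ρ β L r.curvature.F) (n + k) H =
    ∑ q ∈ Fintype.piFinset (fun _ : Fin n => Finset.univ.filter fun pl : Fin 4 × Fin 4 => pl.1 < pl.2),
      ∑ p ∈ Fintype.piFinset (fun _ : Fin k => Finset.univ.filter fun pl : Fin 4 × Fin 4 => pl.1 < pl.2),
      ∑ x ∈ Fintype.piFinset (fun _ : Fin n => box 4 L),
      ∑ y ∈ Fintype.piFinset (fun _ : Fin k => box 4 L),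
        conj (Fi (fun l => timeReflection 4 (a • siteToE (x (Fin.rev l))))) * Fj (fun l => a • siteToE (y l)) *
          (torusMomentStr r.ρ β L (fun l U => plaquetteObs r.ρ 0 (Fin.append q p l).1 (Fin.append q p l).2 U)
            (Fin.append (fun l => wilsonTorusMean r.ρ β L (fun U => plaquetteObs r.ρ 0 (q l).1 (q l).2 U))
              (fun l => wilsonTorusMean r.ρ β L (fun U => plaquetteObs r.ρ 0 (p l).1 (p l).2 U)))
            (Fin.append x y) : ℂ) := by
  rw [latticeDist_dens_eq_sum_latticeDistStr, sum_piFinset_append]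
  refine Finset.sum_congr rfl fun q _ => Finset.sum_congr rfl fun p _ => ?_
  rw [latticeDistStr_apply, sum_piFinset_append]
  refine Finset.sum_congr rfl fun x _ => Finset.sum_congr rfl fun y _ => ?_
  rw [hH, osAdjoint_apply, append_comp_eq (fun pl : Fin 4 × Fin 4 => wilsonTorusMean r.ρ β L
    (fun U => plaquetteObs r.ρ 0 pl.1 pl.2 U)) q p]
  simp only [Function.comp_apply, Function.comp_def, Fin.append_left, Fin.append_right]
  ring

/-! ### P: the reindexed square as `H` at shifted points -/

/-- **P.** The summand of the reindexed reflection-positivity term (toolkit XIX) is `H` at the shifted points. -/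
theorem rpShifted_eq_apply_H (a : ℝ) {n k : ℕ} (Fi : 𝓢((Fin n → E4), ℂ)) (Fj : 𝓢((Fin k → E4), ℂ))
    (H : 𝓢((Fin (n + k) → E4), ℂ)) (hH : IsAppendTensorOf H (osAdjoint Fi) Fj)
    (q : Fin n → Fin 4 × Fin 4) (x : Fin n → Site 4) (y : Fin k → Site 4) :
    conj (Fi (fun l => timeReflection 4 (a • siteToE (x (Fin.rev l))) +
        (a * (1 - if (q (Fin.rev l)).1 = 0 then 1 else 0)) • siteToE (Pi.single (0 : Fin 4) (1 : ℤ)))) *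
      Fj (fun l => a • siteToE (y l)) =
    H ((fun l => a • siteToE (Fin.append x y l)) + cshift a q k) := by
  rw [hH, osAdjoint_apply]
  congr 2
  · congr 1
    funext l
    simp only [Function.comp_apply, Pi.add_apply, cshift, Fin.append_left, map_add, map_smul, map_neg,
      timeReflection_siteToE_single, smul_neg, neg_smul, neg_neg]
  · funext l
    simp [cshift]

/-! ### Z − P = O(a) -/

/-- **The reflection-positivity defect.**  Given the shift-defect bound for plane strings of length `n + k` at
`(β, L, a)` (the joint soft legs export it along the scheme), the lattice OS form `Z` and the reindexed square `P`
differ by at most `6ⁿ 6ᵏ · 2 a K^{n+k} Σ⁺(H)`. -/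
theorem norm_rpDefect_le (r : LatticeRep G) (β : ℝ) (L : ℕ) {a K : ℝ} (ha : 0 ≤ a) (hK : 0 ≤ K) {n k : ℕ}
    (Fi : 𝓢((Fin n → E4), ℂ)) (Fj : 𝓢((Fin k → E4), ℂ)) (H : 𝓢((Fin (n + k) → E4), ℂ))
    (hH : IsAppendTensorOf H (osAdjoint Fi) Fj)
    (hdef : ∀ rr : Fin (n + k) → Fin 4 × Fin 4, (∀ i, (rr i).1 < (rr i).2) → ∀ c : Fin (n + k) → E4, (∀ l, ‖c l‖ ≤ a) →
      ‖∑ z ∈ Fintype.piFinset (fun _ : Fin (n + k) => box 4 L),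
          ((torusMomentStr r.ρ β L (fun i U => plaquetteObs r.ρ 0 (rr i).1 (rr i).2 U)
            (fun i => wilsonTorusMean r.ρ β L (fun U => plaquetteObs r.ρ 0 (rr i).1 (rr i).2 U)) z : ℝ) : ℂ) *
          (H ((fun l => a • siteToE (z l)) + c) - H (fun l => a • siteToE (z l)))‖ ≤
        2 * ‖c‖ * K ^ (n + k) * (SchwartzMap.seminorm ℂ 0 (4 * (n + k) + 1) H +
          SchwartzMap.seminorm ℂ (6 * (n + k)) (4 * (n + k) + 1) H + SchwartzMap.seminorm ℂ 0 1 H +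
          SchwartzMap.seminorm ℂ (6 * (n + k)) 1 H + SchwartzMap.seminorm ℂ (10 * (n + k)) 1 H)) :
    ‖latticeDist r.ρ β L a r.curvature.F (wilsonTorusMean r.ρ β L r.curvature.F) (n + k) H -
      ∑ q ∈ Fintype.piFinset (fun _ : Fin n => Finset.univ.filter fun pl : Fin 4 × Fin 4 => pl.1 < pl.2),
        ∑ p ∈ Fintype.piFinset (fun _ : Fin k => Finset.univ.filter fun pl : Fin 4 × Fin 4 => pl.1 < pl.2),
        ∑ x ∈ Fintype.piFinset (fun _ : Fin n => box 4 L),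
        ∑ y ∈ Fintype.piFinset (fun _ : Fin k => box 4 L),
          conj (Fi (fun l => timeReflection 4 (a • siteToE (x (Fin.rev l))) +
              (a * (1 - if (q (Fin.rev l)).1 = 0 then 1 else 0)) • siteToE (Pi.single (0 : Fin 4) (1 : ℤ)))) *
            Fj (fun l => a • siteToE (y l)) *
            (torusMomentStr r.ρ β L (fun l U => plaquetteObs r.ρ 0 (Fin.append q p l).1 (Fin.append q p l).2 U)
              (Fin.append (fun l => wilsonTorusMean r.ρ β L (fun U => plaquetteObs r.ρ 0 (q l).1 (q l).2 U))
                (fun l => wilsonTorusMean r.ρ β L (fun U => plaquetteObs r.ρ 0 (p l).1 (p l).2 U)))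
              (Fin.append x y) : ℂ)‖ ≤
      6 ^ n * 6 ^ k * (2 * a * K ^ (n + k) * (SchwartzMap.seminorm ℂ 0 (4 * (n + k) + 1) H +
          SchwartzMap.seminorm ℂ (6 * (n + k)) (4 * (n + k) + 1) H + SchwartzMap.seminorm ℂ 0 1 H +
          SchwartzMap.seminorm ℂ (6 * (n + k)) 1 H + SchwartzMap.seminorm ℂ (10 * (n + k)) 1 H)) := by
  classical
  set Sp : ℝ := SchwartzMap.seminorm ℂ 0 (4 * (n + k) + 1) H +
    SchwartzMap.seminorm ℂ (6 * (n + k)) (4 * (n + k) + 1) H + SchwartzMap.seminorm ℂ 0 1 H +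
    SchwartzMap.seminorm ℂ (6 * (n + k)) 1 H + SchwartzMap.seminorm ℂ (10 * (n + k)) 1 H with hSp
  -- the string weight and the base points, as functions of the appended string / multi-site
  set W : (Fin (n + k) → Fin 4 × Fin 4) → (Fin (n + k) → Site 4) → ℝ := fun rr z =>
    torusMomentStr r.ρ β L (fun i U => plaquetteObs r.ρ 0 (rr i).1 (rr i).2 U)
      (fun i => wilsonTorusMean r.ρ β L (fun U => plaquetteObs r.ρ 0 (rr i).1 (rr i).2 U)) z with hW
  -- Z and P termwise
  rw [latticeDist_dens_eq_rpSum r β L a Fi Fj H hH]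
  have hP : ∀ q p x y,
      conj (Fi (fun l => timeReflection 4 (a • siteToE (x (Fin.rev l))) +
          (a * (1 - if (q (Fin.rev l)).1 = 0 then 1 else 0)) • siteToE (Pi.single (0 : Fin 4) (1 : ℤ)))) *
        Fj (fun l => a • siteToE (y l)) *
        (torusMomentStr r.ρ β L (fun l U => plaquetteObs r.ρ 0 (Fin.append q p l).1 (Fin.append q p l).2 U)
          (Fin.append (fun l => wilsonTorusMean r.ρ β L (fun U => plaquetteObs r.ρ 0 (q l).1 (q l).2 U))
            (fun l => wilsonTorusMean r.ρ β L (fun U => plaquetteObs r.ρ 0 (p l).1 (p l).2 U)))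
          (Fin.append x y) : ℂ) =
      (W (Fin.append q p) (Fin.append x y) : ℂ) * H ((fun l => a • siteToE (Fin.append x y l)) + cshift a q k) := by
    intro q p x y
    rw [rpShifted_eq_apply_H a Fi Fj H hH, hW, append_comp_eq (fun pl : Fin 4 × Fin 4 => wilsonTorusMean r.ρ β L
      (fun U => plaquetteObs r.ρ 0 pl.1 pl.2 U)) q p]
    ring
  have hZ : ∀ q p x y,
      conj (Fi (fun l => timeReflection 4 (a • siteToE (x (Fin.rev l))))) * Fj (fun l => a • siteToE (y l)) *
        (torusMomentStr r.ρ β L (fun l U => plaquetteObs r.ρ 0 (Fin.append q p l).1 (Fin.append q p l).2 U)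
          (Fin.append (fun l => wilsonTorusMean r.ρ β L (fun U => plaquetteObs r.ρ 0 (q l).1 (q l).2 U))
            (fun l => wilsonTorusMean r.ρ β L (fun U => plaquetteObs r.ρ 0 (p l).1 (p l).2 U)))
          (Fin.append x y) : ℂ) =
      (W (Fin.append q p) (Fin.append x y) : ℂ) * H (fun l => a • siteToE (Fin.append x y l)) := by
    intro q p x y
    rw [hH, osAdjoint_apply, hW, append_comp_eq (fun pl : Fin 4 × Fin 4 => wilsonTorusMean r.ρ β L
      (fun U => plaquetteObs r.ρ 0 pl.1 pl.2 U)) q p]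
    simp only [Function.comp_apply, Function.comp_def, Fin.append_left, Fin.append_right]
    ring
  simp_rw [hZ, hP]
  rw [← Finset.sum_sub_distrib]
  simp_rw [← Finset.sum_sub_distrib, ← mul_sub]
  -- merge the site sums and apply the defect bound string by string
  have hcardn : (Fintype.piFinset (fun _ : Fin n => Finset.univ.filter fun pl : Fin 4 × Fin 4 => pl.1 < pl.2)).card =
      6 ^ n := by rw [Fintype.card_piFinset, Finset.prod_const, card_planes, Finset.card_univ, Fintype.card_fin]
  have hcardk : (Fintype.piFinset (fun _ : Fin k => Finset.univ.filter fun pl : Fin 4 × Fin 4 => pl.1 < pl.2)).card =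
      6 ^ k := by rw [Fintype.card_piFinset, Finset.prod_const, card_planes, Finset.card_univ, Fintype.card_fin]
  have hterm : ∀ q ∈ Fintype.piFinset (fun _ : Fin n => Finset.univ.filter fun pl : Fin 4 × Fin 4 => pl.1 < pl.2),
      ∀ p ∈ Fintype.piFinset (fun _ : Fin k => Finset.univ.filter fun pl : Fin 4 × Fin 4 => pl.1 < pl.2),
      ‖∑ x ∈ Fintype.piFinset (fun _ : Fin n => box 4 L), ∑ y ∈ Fintype.piFinset (fun _ : Fin k => box 4 L),
          (W (Fin.append q p) (Fin.append x y) : ℂ) *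
            (H (fun l => a • siteToE (Fin.append x y l)) - H ((fun l => a • siteToE (Fin.append x y l)) + cshift a q k))‖ ≤
        2 * a * K ^ (n + k) * Sp := by
    intro q hq p hp
    have hqp : ∀ i, (Fin.append q p i).1 < (Fin.append q p i).2 := by
      intro i
      induction i using Fin.addCases with
      | left i => rw [Fin.append_left]; exact (mem_planeStrings_iff q).1 hq i
      | right j => rw [Fin.append_right]; exact (mem_planeStrings_iff p).1 hp j
    have h := hdef (Fin.append q p) hqp (cshift a q k) (norm_cshift_apply_le ha q k)
    rw [← sum_piFinset_append (box 4 L) (fun z => (W (Fin.append q p) z : ℂ) *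
      (H (fun l => a • siteToE (z l)) - H ((fun l => a • siteToE (z l)) + cshift a q k)))]
    have hflip : ∑ z ∈ Fintype.piFinset (fun _ : Fin (n + k) => box 4 L), (W (Fin.append q p) z : ℂ) *
        (H (fun l => a • siteToE (z l)) - H ((fun l => a • siteToE (z l)) + cshift a q k)) =
        -∑ z ∈ Fintype.piFinset (fun _ : Fin (n + k) => box 4 L), (W (Fin.append q p) z : ℂ) *
          (H ((fun l => a • siteToE (z l)) + cshift a q k) - H (fun l => a • siteToE (z l))) := by
      rw [← Finset.sum_neg_distrib]
      exact Finset.sum_congr rfl fun z _ => by ring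
    rw [hflip, norm_neg]
    refine h.trans ?_
    have hSp0 : 0 ≤ Sp := by rw [hSp]; positivity
    have := norm_cshift_le ha q k
    gcongr
  calc _ ≤ ∑ q ∈ Fintype.piFinset (fun _ : Fin n => Finset.univ.filter fun pl : Fin 4 × Fin 4 => pl.1 < pl.2),
        ‖∑ p ∈ Fintype.piFinset (fun _ : Fin k => Finset.univ.filter fun pl : Fin 4 × Fin 4 => pl.1 < pl.2),
          ∑ x ∈ Fintype.piFinset (fun _ : Fin n => box 4 L), ∑ y ∈ Fintype.piFinset (fun _ : Fin k => box 4 L),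
          (W (Fin.append q p) (Fin.append x y) : ℂ) *
            (H (fun l => a • siteToE (Fin.append x y l)) - H ((fun l => a • siteToE (Fin.append x y l)) + cshift a q k))‖ :=
        norm_sum_le _ _
    _ ≤ ∑ q ∈ Fintype.piFinset (fun _ : Fin n => Finset.univ.filter fun pl : Fin 4 × Fin 4 => pl.1 < pl.2),
        ∑ p ∈ Fintype.piFinset (fun _ : Fin k => Finset.univ.filter fun pl : Fin 4 × Fin 4 => pl.1 < pl.2),
          (2 * a * K ^ (n + k) * Sp) := Finset.sum_le_sum fun q hq => (norm_sum_le _ _).trans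
          (Finset.sum_le_sum fun p hp => hterm q hq p hp)
    _ = 6 ^ n * 6 ^ k * (2 * a * K ^ (n + k) * Sp) := by
        rw [Finset.sum_const, Finset.sum_const, hcardn, hcardk, nsmul_eq_mul, nsmul_eq_mul]; push_cast; ring

end Summit.QuantumFields.YangMills.Theorems.OSLegsFromFemtoAndGap

end
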